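/-
Copyright (c) 2026 the pub-hodgecm-mathlib formalisation cell (harness21).  Prover seat hodgecm-mathlib-K2E5-p12 (g2), Track B «K2-LIT» ∕ h413, deal (D29) (δ-U2) of
K2E3-plan (g2) on the §L line lead K2E3-p12 (g3)'s recommendation 02:24:17Z.  2026-09-04.
-/
import Summits.HodgeConjecture.HodgeConjecture.Theorems.K2E3U2LieTraceCoordinates            -- ★ FILE C (this seat): `exists_addEquiv_trace_eq`; brings ★ FILE A∕B, `lieOfForm`, `lieFourier`
import Summits.HodgeConjecture.HodgeConjecture.Theorems.K2E3GLnNilpotentFourierPointSupport   -- ★ p856457 (K2E3-p12 g3): `apply_eq_apply_indicator_mul_of_notMem_tsupport`; brings `piFourierSB_mem_schwartzBruhat`, `IsLocSmooth` kit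
import Literature.AlgebraicGeometry.ShimuraVarieties.UnitaryBallQuotientDatum                -- ★ `hermForm`
import HarnessLib

/-!
# K2 ∕ E3, (δ-U2) — THE POINT-SUPPORTED PART OF (L-B_U)′ ON `𝔲₂(H_w)`, AND (L-B_U)′ OUTRIGHT AT AN ANISOTROPIC NON-SPLIT PLACE

Cell `pub/hodgecm-mathlib` (D-0151), Track B «K2-LIT», crux H413 = `stmt-HodgeConjecture-24833` (lane `--supports … --as helper`, count-neutral); seat K2E5-p12 (g2);
dealer K2E3-plan (g2) deal (D29) 2026-09-04T02:28Z = §L line lead K2E3-p12 (g3)'s (δ-U2).  THEOREMS ONLY (no definition ∕ instance ∕ notation ∕ named fact ∕ `sorry`);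
never imports `Cruxes/…/Lines`.  The 𝔲₂-twin of ★ p856457 `K2E3GLnNilpotentFourierPointSupport` §§1–3, for the hosted socket (L-B_U)′ `sig_K2E3UNilpotentFourierRegular`
(U12 SIGS ED. 7 :373; Harish-Chandra's Thm. 4.4 ∕ §21 for `J(𝒩)` on `𝔲(σ_w, H_w)`): at `N = 2` and a place where `H_w` is ANISOTROPIC the nilpotent cone of `𝔲₂(H_w)`
is `{0}`, `J(𝒩) = ℂ·δ₀`, and the socket holds VERBATIM.

SETTING.  `L` CM, `v` finite, `w ∣ v` non-split (`c • w = w`), `σ_w = galAdicCompletionMap c hw`, `ι = toPlace v w : L⁺_v → L_w`, `H ∈ M₂(L)` hermitian, `det H ≠ 0`,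
`H_w = placeForm H w`, `𝔲 = lieOfForm σ_w H_w`, `μ𝔤` an additive Haar measure on `↥𝔲`, `ψ` a continuous non-trivial character of `L_w` NON-TRIVIAL ON `ι(L⁺_v)` (the C′
antecedent of :373), `𝓕f(Y) = ∫ ψ(tr(Y·X)) f(X) dμ𝔤` (★ `lieFourier`).
* §1 **`isLocSmooth_lieFourier`** — `𝓕` maps `C_c^∞(𝔲)` (★ `IsLocSmooth`) to itself: along the trace chart `e₄ : ↥𝔲 ≃ (L⁺_v)⁴` of ★ FILE C
  (`tr(Y·X) = ι(Σ βᵢ (e₄Y)ᵢ (e₄X)ᵢ)`), `𝓕f = ((f ∘ e₄⁻¹)^ for ψ ∘ ι and e₄_*μ𝔤) ∘ (β · e₄)`, and ★ `piFourierSB_mem_schwartzBruhat` (Weil VII §2 Prop. 2 on `F^ι`); `ψ ∘ ι` is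
  continuous and non-trivial EXACTLY by the C′ antecedent (★ `galAdicCompletionMap_eq_self_iff_mem_range`).  `lieFourier_apply_zero`: `𝓕f(0) = ∫ f`.
* §2 **`lieNilpotentFourierRegular_of_pointSupport`** — the `δ₀`-part: for `T` additive and homogeneous on `C_c^∞(𝔲)` with `T f = 0` whenever `0 ∉ supp f`, the CONSTANT
  `Fn ≡ T(1_{K₀})` (`K₀ = e₄⁻¹(𝒪⁴)`, ★ `apply_eq_apply_indicator_mul_of_notMem_tsupport`) satisfies all four conclusions of :373 (`η^{1∕4}`-weight bounded on compacta by continuity).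
* §3 **`eq_zero_of_isNilpotent_of_anisotropic`** — `X ∈ 𝔲(σ, J)` nilpotent (`2 × 2`, any field) with `J` ANISOTROPIC (`h(u,u) = 0 ⇒ u = 0`, ★ `hermForm`) is `0`:
  `X² = 0` (Cayley–Hamilton), `h(Xu, Xu) = ᵗ(σu)·ᵗ(σX)·J·X·u = −ᵗ(σu)·J·X²·u = 0`.
* §4 **`u2_nilpotentFourierRegular_of_anisotropic`** — (L-B_U)′ ED. 7 :373 VERBATIM at `N := 2`, under the one extra binder
  `hanis : ∀ u, hermForm σ_w H_w u u = 0 → u = 0`.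
[HarishChandra1999AdmissibleDistributions, Thm. 3.9, Thm. 4.4 p. 11, §21 p. 87] [WeilBNT1967, Ch. VII §2 Prop. 2] [PlatonovRapinchuk1994, §2.3, §6.4 (anisotropic ⇒ no unipotents)].
HONEST LABEL: HC_CM is proved only modulo the 7 printed citations (2 remaining named inputs: hLiu418 = `stmt-HodgeConjecture-24832`, h413 = `stmt-HodgeConjecture-24833`)
until rung 0 closes; count-neutral ((L-B_U)′ at an ISOTROPIC `w` — the two regular nilpotent `U(1,1)(L⁺_v)`-orbits — is NOT proved here).

## References
* [HarishChandra1999AdmissibleDistributions] Harish-Chandra (DeBacker–Sally), *Admissible Invariant Distributions on Reductive p-adic Groups* (1999), Thm. 3.9, Thm. 4.4, §21.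
* [WeilBNT1967] A. Weil, *Basic Number Theory* (1967), Ch. VII §2, Prop. 2.
* [PlatonovRapinchuk1994] V. Platonov, A. Rapinchuk, *Algebraic Groups and Number Theory* (1994), §2.3, §6.4.
-/

set_option autoImplicit false
set_option linter.dupNamespace false   -- `Summit.HodgeConjecture.HodgeConjecture.…` (D-0017 nested layout; lakefile exemption for Summits)

noncomputable section

open MeasureTheory Filter Topology NumberField IsDedekindDomain
open scoped Matrix MatrixGroups NNReal
open Literature.NumberTheory.Rogawski1990 Literature.NumberTheory.Automorphic Literature.NumberTheory.Automorphic.UnitaryGroup Literature.NumberTheory.Automorphic.LocalFieldHaar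
open Literature.NumberTheory.GaloisRepresentations Literature.NumberTheory.GaloisRepresentations.IsNonarchimedeanLocalField
open Summit.HodgeConjecture.HodgeConjecture.Cruxes.H413.K2E3LieUnitary
open Summit.HodgeConjecture.HodgeConjecture.Cruxes.H413.K2E3GLnNilpotentFourierPointSupport (apply_eq_apply_indicator_mul_of_notMem_tsupport)
open Summit.HodgeConjecture.HodgeConjecture.Cruxes.H413.K2E3U2LieTraceCoordinates (exists_addEquiv_trace_eq)

namespace Summit.HodgeConjecture.HodgeConjecture.Cruxes.H413.K2E3U2NilpotentFourierPointSupport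

/-! ## §3 (first, field-generic)  Anisotropic forms have no non-zero nilpotents in `𝔲₂` -/

section Anisotropic

variable {K : Type*} [Field K] (σ : K →+* K)

/-- **`X ∈ 𝔲(σ, J)` nilpotent with `J` anisotropic ⇒ `X = 0`** (`2 × 2`): `X² = 0` by Cayley–Hamilton, and for every `u`, `h(Xu, Xu) = ᵗσ(Xu)·J·Xu = ᵗ(σu)·(ᵗ(σX)J)·Xu =
−ᵗ(σu)·J·X²u = 0`, so `Xu = 0`. [cite: PlatonovRapinchuk1994, §2.3, §6.4] [cite: HarishChandra1999AdmissibleDistributions, §3 p. 8] -/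
theorem eq_zero_of_isNilpotent_of_anisotropic {J : Matrix (Fin 2) (Fin 2) K}
    (hanis : ∀ u : Fin 2 → K, Literature.AlgebraicGeometry.ShimuraVarieties.hermForm σ J u u = 0 → u = 0)
    {X : Matrix (Fin 2) (Fin 2) K} (hX : X ∈ lieOfForm σ J) (hnil : IsNilpotent X) : X = 0 := by
  classical
  -- `X² = 0`
  have hsq : X * X = 0 := by
    have h1 : X.charpoly = Polynomial.X ^ 2 := by
      have h := (Matrix.isNilpotent_charpoly_sub_pow_of_isNilpotent hnil).eq_zero
      rw [sub_eq_zero] at h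
      simpa using h
    have h2 := Matrix.aeval_self_charpoly X
    rwa [h1, map_pow, Polynomial.aeval_X, pow_two] at h2
  -- every column `Xu` is isotropic, hence zero
  have hcol : ∀ u : Fin 2 → K, X *ᵥ u = 0 := by
    intro u
    apply hanis
    have hskew := (mem_lieOfForm_iff' X).1 hX
    show (⇑σ ∘ (X *ᵥ u)) ⬝ᵥ (J *ᵥ (X *ᵥ u)) = 0
    have hmap : (⇑σ ∘ (X *ᵥ u)) = X.map σ *ᵥ (⇑σ ∘ u) := funext fun i => RingHom.map_mulVec σ X u i
    rw [hmap, ← Matrix.vecMul_transpose, ← Matrix.dotProduct_mulVec, Matrix.mulVec_mulVec, Matrix.mulVec_mulVec, hskew, Matrix.neg_mul, Matrix.mul_assoc, hsq,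
      Matrix.mul_zero, neg_zero, Matrix.zero_mulVec, dotProduct_zero]
  ext i j
  have h := congrFun (hcol (Pi.single j 1)) i
  rw [Matrix.mulVec_single_one] at h
  exact h

end Anisotropic

/-! ## §1  The Fourier transform preserves `C_c^∞(𝔲₂(H_w))` -/

section CM

variable (L : Type) [Field L] [NumberField L] [IsCMField L] (v : HeightOneSpectrum (𝓞 ↥(maximalRealSubfield L)))
  (w : UnitaryGroup.PlacesOver L v) (hw : IsCMField.complexConj L • w.1 = w.1)

omit [IsCMField L] in
/-- `𝓕f(0) = ∫ f dμ𝔤` (`ψ(0) = 1`). [cite: HarishChandra1999AdmissibleDistributions, §4 p. 11] -/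
theorem lieFourier_apply_zero {σ : w.1.adicCompletion L →+* w.1.adicCompletion L} {J : Matrix (Fin 2) (Fin 2) (w.1.adicCompletion L)} (ψ : AddChar (w.1.adicCompletion L) Circle)
    [MeasurableSpace ↥(lieOfForm σ J)] (μ𝔤 : Measure ↥(lieOfForm σ J)) (f : ↥(lieOfForm σ J) → ℂ) :
    lieFourier σ J (fun x : w.1.adicCompletion L => ((ψ x : Circle) : ℂ)) μ𝔤 f 0 = ∫ X, f X ∂μ𝔤 := by
  rw [lieFourier_apply]
  simp only [ZeroMemClass.coe_zero, zero_mul, Matrix.trace_zero, AddChar.map_zero_eq_one, Circle.coe_one, one_mul]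

set_option maxHeartbeats 1600000 in
include hw in
/-- **The Fourier transform `𝓕f(Y) = ∫ ψ(tr(Y·X)) f(X) dμ𝔤` maps `C_c^∞(𝔲₂(H_w))` to itself** (`w` non-split, `H` hermitian with `det H ≠ 0`, `μ𝔤` left-invariant Borel,
`ψ` continuous and non-trivial on `ι(L⁺_v)`): transport of ★ `piFourierSB_mem_schwartzBruhat` on `(L⁺_v)⁴` along the trace chart `e₄` of ★ FILE C — `tr(Y·X) =
ι(⟨e₄X, β·e₄Y⟩)`, so `𝓕f = ((f ∘ e₄⁻¹)^_{ψ∘ι, e₄_*μ𝔤}) ∘ (β·e₄)`. [cite: WeilBNT1967, Ch. VII §2, Prop. 2] [cite: HarishChandra1999AdmissibleDistributions, §4 p. 11] -/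
theorem isLocSmooth_lieFourier (H : Matrix (Fin 2) (Fin 2) L) (hH : (H.map (cmConjRingHom L))ᵀ = H) (hdet : H.det ≠ 0)
    (ψ : AddChar (w.1.adicCompletion L) Circle) (hψ : ψ.IsContinuousNontrivial)
    (hψι : ∃ a : w.1.adicCompletion L, galAdicCompletionMap (L := L) (IsCMField.complexConj L) hw a = a ∧ ψ a ≠ 1)
    [MeasurableSpace ↥(lieOfForm (galAdicCompletionMap (L := L) (IsCMField.complexConj L) hw) (UnitaryGroup.placeForm H w.1))]
    [BorelSpace ↥(lieOfForm (galAdicCompletionMap (L := L) (IsCMField.complexConj L) hw) (UnitaryGroup.placeForm H w.1))]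
    (μ𝔤 : Measure ↥(lieOfForm (galAdicCompletionMap (L := L) (IsCMField.complexConj L) hw) (UnitaryGroup.placeForm H w.1))) [μ𝔤.IsAddLeftInvariant]
    {f : ↥(lieOfForm (galAdicCompletionMap (L := L) (IsCMField.complexConj L) hw) (UnitaryGroup.placeForm H w.1)) → ℂ} (hf : IsLocSmooth f) :
    IsLocSmooth (lieFourier (galAdicCompletionMap (L := L) (IsCMField.complexConj L) hw) (UnitaryGroup.placeForm H w.1)
      (fun x : w.1.adicCompletion L => ((ψ x : Circle) : ℂ)) μ𝔤 f) := by
  classical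
  haveI : Algebra.IsQuadraticExtension ↥(maximalRealSubfield L) L := IsCMField.isQuadraticExtension L
  have hc1 := IsCMField.complexConj_ne_one L
  -- the character `ψ ∘ ι` of `L⁺_v`
  set ψF : AddChar (v.adicCompletion ↥(maximalRealSubfield L)) Circle := ψ.compAddMonoidHom (toPlace v w).toAddMonoidHom with hψF
  have hψFa : ∀ t, ψF t = ψ (toPlace v w t) := fun t => rfl
  have hψF' : ψF.IsContinuousNontrivial := by
    refine ⟨?_, fun h0 => ?_⟩
    · show Continuous fun t => ψF t
      simp only [hψFa]
      exact hψ.1.comp (continuous_toPlace v w)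
    · obtain ⟨a, ha, hne⟩ := hψι
      obtain ⟨t, rfl⟩ := (galAdicCompletionMap_eq_self_iff_mem_range (IsCMField.complexConj L) hc1 v w hw a).1 ha
      exact hne (by rw [← toPlace_eq_algebraMap_adicCompletion, ← hψFa, h0, AddChar.zero_apply])
  -- the trace chart and the scaling by `β`
  obtain ⟨e, β, he, hes, hβ0, htr⟩ := exists_addEquiv_trace_eq L v w hw H hH hdet
  let eH : ↥(lieOfForm (galAdicCompletionMap (L := L) (IsCMField.complexConj L) hw) (UnitaryGroup.placeForm H w.1)) ≃ₜ (Fin 4 → v.adicCompletion ↥(maximalRealSubfield L)) :=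
    Homeomorph.mk e.toEquiv he hes
  let A : (Fin 4 → v.adicCompletion ↥(maximalRealSubfield L)) ≃ₜ (Fin 4 → v.adicCompletion ↥(maximalRealSubfield L)) :=
    { toFun := fun y i => β i * y i
      invFun := fun y i => (β i)⁻¹ * y i
      left_inv := fun y => funext fun i => by simp [hβ0 i]
      right_inv := fun y => funext fun i => by simp [hβ0 i]
      continuous_toFun := continuous_pi fun i => continuous_const.mul (continuous_apply i)
      continuous_invFun := continuous_pi fun i => continuous_const.mul (continuous_apply i) }
  -- the transported measurable structure on `(L⁺_v)⁴` is Borel, the transported measure is left-invariant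
  letI mPi : MeasurableSpace (Fin 4 → v.adicCompletion ↥(maximalRealSubfield L)) :=
    MeasurableSpace.comap eH.symm ‹MeasurableSpace ↥(lieOfForm (galAdicCompletionMap (L := L) (IsCMField.complexConj L) hw) (UnitaryGroup.placeForm H w.1))›
  let em : ↥(lieOfForm (galAdicCompletionMap (L := L) (IsCMField.complexConj L) hw) (UnitaryGroup.placeForm H w.1)) ≃ᵐ (Fin 4 → v.adicCompletion ↥(maximalRealSubfield L)) :=
    { toEquiv := eH.toEquiv
      measurable_toFun := by
        refine measurable_iff_comap_le.2 (le_of_eq ?_)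
        rw [MeasurableSpace.comap_comp]
        convert MeasurableSpace.comap_id using 2
        funext X
        exact eH.symm_apply_apply X
      measurable_invFun := measurable_iff_comap_le.2 le_rfl }
  haveI : BorelSpace (Fin 4 → v.adicCompletion ↥(maximalRealSubfield L)) := em.symm.measurableEmbedding.borelSpace eH.symm.isInducing
  set ν : Measure (Fin 4 → v.adicCompletion ↥(maximalRealSubfield L)) := μ𝔤.map em with hν
  haveI : ν.IsAddLeftInvariant := by
    have h := isAddLeftInvariant_map (μ := μ𝔤)
      (⟨e, fun X Y => e.map_add X Y⟩ : AddHom ↥(lieOfForm (galAdicCompletionMap (L := L) (IsCMField.complexConj L) hw) (UnitaryGroup.placeForm H w.1))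
        (Fin 4 → v.adicCompletion ↥(maximalRealSubfield L))) em.measurable e.surjective
    exact h
  -- `𝓕f = (f ∘ e⁻¹)^ ∘ (β · e)`
  have hΦ : (f ∘ em.symm) ∈ SchwartzBruhat (Fin 4 → v.adicCompletion ↥(maximalRealSubfield L)) :=
    (mem_schwartzBruhat_iff).2 ⟨hf.1.comp_continuous eH.symm.continuous, hf.2.comp_homeomorph eH.symm⟩
  have hkey : lieFourier (galAdicCompletionMap (L := L) (IsCMField.complexConj L) hw) (UnitaryGroup.placeForm H w.1)
      (fun x : w.1.adicCompletion L => ((ψ x : Circle) : ℂ)) μ𝔤 f = (piFourierSB ψF ν (f ∘ em.symm)) ∘ (eH.trans A) := by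
    funext Y
    rw [lieFourier_apply]
    simp only [Function.comp_apply, piFourierSB_apply, hν]
    rw [integral_map_equiv]
    refine integral_congr_ae (Eventually.of_forall fun X => ?_)
    simp only [MeasurableEquiv.symm_apply_apply, hψFa]
    have h1 : toPlace v w ((em X) ⬝ᵥ (eH.trans A) Y) = Matrix.trace (Y.1 * X.1) := by
      rw [htr Y X]
      congr 1
      show ∑ i, e X i * (β i * e Y i) = ∑ i, β i * e Y i * e X i
      exact Finset.sum_congr rfl fun i _ => by ring
    rw [h1]
  rw [hkey]
  have hsb := piFourierSB_mem_schwartzBruhat ν hψF' hΦ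
  rw [mem_schwartzBruhat_iff] at hsb
  exact ⟨hsb.1.comp_continuous (eH.trans A).continuous, hsb.2.comp_homeomorph (eH.trans A)⟩

/-! ## §2  The `δ₀`-part of (L-B_U)′ on `𝔲₂(H_w)` -/

set_option maxHeartbeats 1600000 in
include hw in
/-- **The `δ₀`-part of (L-B_U)′ «Thm. 4.4 ∕ §21 for `J(𝒩)` on `𝔲₂(H_w)`»** (socket currency of :373 at `N = 2`, with the support clause strengthened from `𝒩` to `{0}`): for `T`
additive and homogeneous on `C_c^∞(𝔲)` with `T f = 0` whenever `0 ∉ supp f`, the CONSTANT `Fn ≡ c := T(1_{K₀})` (`K₀ = e₄⁻¹(𝒪⁴)` compact open) is locally integrable,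
represents `T̂` (`T(𝓕f) = c·𝓕f(0) = ∫ f·c dμ𝔤`, §1 + ★ `apply_eq_apply_indicator_mul_of_notMem_tsupport`), is locally constant, and `(√√|disc χ_X|_{L_w})·|c|` is bounded on
compacta. [cite: HarishChandra1999AdmissibleDistributions, Thm. 4.4 p. 11, Thm. 3.9 p. 10, §21 p. 87] -/
theorem lieNilpotentFourierRegular_of_pointSupport (H : Matrix (Fin 2) (Fin 2) L) (hH : (H.map (cmConjRingHom L))ᵀ = H) (hdet : H.det ≠ 0)
    (ψ : AddChar (w.1.adicCompletion L) Circle) (hψ : ψ.IsContinuousNontrivial)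
    (hψι : ∃ a : w.1.adicCompletion L, galAdicCompletionMap (L := L) (IsCMField.complexConj L) hw a = a ∧ ψ a ≠ 1)
    [MeasurableSpace ↥(lieOfForm (galAdicCompletionMap (L := L) (IsCMField.complexConj L) hw) (UnitaryGroup.placeForm H w.1))]
    [BorelSpace ↥(lieOfForm (galAdicCompletionMap (L := L) (IsCMField.complexConj L) hw) (UnitaryGroup.placeForm H w.1))]
    (μ𝔤 : Measure ↥(lieOfForm (galAdicCompletionMap (L := L) (IsCMField.complexConj L) hw) (UnitaryGroup.placeForm H w.1))) [μ𝔤.IsAddHaarMeasure]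
    (T : (↥(lieOfForm (galAdicCompletionMap (L := L) (IsCMField.complexConj L) hw) (UnitaryGroup.placeForm H w.1)) → ℂ) → ℂ)
    (hadd : ∀ f₁ f₂ : ↥(lieOfForm (galAdicCompletionMap (L := L) (IsCMField.complexConj L) hw) (UnitaryGroup.placeForm H w.1)) → ℂ,
      IsLocSmooth f₁ → IsLocSmooth f₂ → T (f₁ + f₂) = T f₁ + T f₂)
    (hsmul : ∀ (a : ℂ) (f : ↥(lieOfForm (galAdicCompletionMap (L := L) (IsCMField.complexConj L) hw) (UnitaryGroup.placeForm H w.1)) → ℂ), IsLocSmooth f → T (a • f) = a * T f)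
    (h0 : ∀ f : ↥(lieOfForm (galAdicCompletionMap (L := L) (IsCMField.complexConj L) hw) (UnitaryGroup.placeForm H w.1)) → ℂ, IsLocSmooth f →
      (0 : ↥(lieOfForm (galAdicCompletionMap (L := L) (IsCMField.complexConj L) hw) (UnitaryGroup.placeForm H w.1))) ∉ tsupport f → T f = 0) :
    ∃ Fn : ↥(lieOfForm (galAdicCompletionMap (L := L) (IsCMField.complexConj L) hw) (UnitaryGroup.placeForm H w.1)) → ℂ, LocallyIntegrable Fn μ𝔤 ∧
      (∀ f : ↥(lieOfForm (galAdicCompletionMap (L := L) (IsCMField.complexConj L) hw) (UnitaryGroup.placeForm H w.1)) → ℂ, IsLocSmooth f →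
        T (lieFourier (galAdicCompletionMap (L := L) (IsCMField.complexConj L) hw) (UnitaryGroup.placeForm H w.1) (fun x : w.1.adicCompletion L => ((ψ x : Circle) : ℂ)) μ𝔤 f) =
          ∫ X, f X * Fn X ∂μ𝔤) ∧
      (∀ X : ↥(lieOfForm (galAdicCompletionMap (L := L) (IsCMField.complexConj L) hw) (UnitaryGroup.placeForm H w.1)), IsUnit X.1.charpoly.discr → ∀ᶠ Y in 𝓝 X, Fn Y = Fn X) ∧
      (∀ C : Set ↥(lieOfForm (galAdicCompletionMap (L := L) (IsCMField.complexConj L) hw) (UnitaryGroup.placeForm H w.1)), IsCompact C → ∃ B : ℝ, ∀ X ∈ C,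
        ((NNReal.sqrt (NNReal.sqrt (normAbs (w.1.adicCompletion L) X.1.charpoly.discr)) : ℝ≥0) : ℝ) * ‖Fn X‖ ≤ B) := by
  classical
  haveI : T2Space (w.1.adicCompletion L) := (isLocalField (w.1.adicCompletion L)).toT2Space
  haveI : LocallyCompactSpace (w.1.adicCompletion L) := (isLocalField (w.1.adicCompletion L)).toLocallyCompactSpace
  haveI : LocallyCompactSpace (Matrix (Fin 2) (Fin 2) (w.1.adicCompletion L)) := Pi.locallyCompactSpace_of_finite
  haveI : LocallyCompactSpace ↥(lieOfForm (galAdicCompletionMap (L := L) (IsCMField.complexConj L) hw) (UnitaryGroup.placeForm H w.1)) :=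
    (Topology.IsClosedEmbedding.subtypeVal (isClosed_lieOfForm (σ := galAdicCompletionMap (L := L) (IsCMField.complexConj L) hw)
      (J := UnitaryGroup.placeForm H w.1) (continuous_galAdicCompletionMap L (IsCMField.complexConj L) hw))).locallyCompactSpace
  -- a compact open neighbourhood of `0`: the preimage of the integer box under the trace chart
  obtain ⟨e, β, he, hes, -, -⟩ := exists_addEquiv_trace_eq L v w hw H hH hdet
  let eH : ↥(lieOfForm (galAdicCompletionMap (L := L) (IsCMField.complexConj L) hw) (UnitaryGroup.placeForm H w.1)) ≃ₜ (Fin 4 → v.adicCompletion ↥(maximalRealSubfield L)) :=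
    Homeomorph.mk e.toEquiv he hes
  set K₀ : Set ↥(lieOfForm (galAdicCompletionMap (L := L) (IsCMField.complexConj L) hw) (UnitaryGroup.placeForm H w.1)) :=
    eH ⁻¹' (Set.univ.pi fun _ : Fin 4 => primePowBall (v.adicCompletion ↥(maximalRealSubfield L)) 0) with hK₀
  have hKo : IsOpen K₀ := (isOpen_set_pi Set.finite_univ fun i _ => isOpen_primePowBall 0).preimage eH.continuous
  have hKc : IsCompact K₀ := eH.isCompact_preimage.2 (isCompact_univ_pi fun _ => isCompact_primePowBall 0)
  have hK0 : (0 : ↥(lieOfForm (galAdicCompletionMap (L := L) (IsCMField.complexConj L) hw) (UnitaryGroup.placeForm H w.1))) ∈ K₀ := by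
    rw [hK₀, Set.mem_preimage]
    refine Set.mem_univ_pi.2 fun i => ?_
    show (e 0) i ∈ _
    rw [map_zero, Pi.zero_apply]
    exact zero_mem_primePowBall 0
  set c : ℂ := T (K₀.indicator fun _ => (1 : ℂ)) with hc
  refine ⟨fun _ => c, locallyIntegrable_const c, fun f hf => ?_, fun X _ => Eventually.of_forall fun Y => rfl, fun C hC => ?_⟩
  · rw [apply_eq_apply_indicator_mul_of_notMem_tsupport hKo hKc hK0 T hadd hsmul h0 (isLocSmooth_lieFourier L v w hw H hH hdet ψ hψ hψι μ𝔤 hf),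
      lieFourier_apply_zero, integral_mul_const, mul_comm]
  · have hcont : Continuous fun X : ↥(lieOfForm (galAdicCompletionMap (L := L) (IsCMField.complexConj L) hw) (UnitaryGroup.placeForm H w.1)) =>
        ((NNReal.sqrt (NNReal.sqrt (normAbs (w.1.adicCompletion L) X.1.charpoly.discr)) : ℝ≥0) : ℝ) * ‖c‖ :=
      (NNReal.continuous_coe.comp (NNReal.continuous_sqrt.comp (NNReal.continuous_sqrt.comp (continuous_normAbs.comp
        (K2E3NormalizedCharBddNearSemisimpleRegular.continuous_discr_charpoly.comp continuous_subtype_val))))).mul continuous_const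
    obtain ⟨B, hB⟩ := hC.bddAbove_image hcont.continuousOn
    exact ⟨B, fun X hX => hB (Set.mem_image_of_mem _ hX)⟩

/-! ## §4  (L-B_U)′ verbatim at `N = 2` for an anisotropic place -/

set_option maxHeartbeats 1600000 in
include hw in
/-- **(L-B_U)′ «Thm. 4.4 ∕ §21 for `J(𝒩)` on `𝔲(σ_w, H_w)`» AT `N = 2` WHEN `H_w` IS ANISOTROPIC** — the hosted socket `sig_K2E3UNilpotentFourierRegular` (U12 SIGS ED. 7 :373)
with `N := 2`, verbatim, under the one extra binder `hanis`: the nilpotent cone of `𝔲₂(H_w)` is `{0}` (§3), so the support clause (iv) of `T ∈ J(𝒩)` says `T f = 0`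
whenever `0 ∉ supp f`, and §2 gives `T̂ = T(1_{K₀})·1`. [cite: HarishChandra1999AdmissibleDistributions, Thm. 4.4 p. 11, §21 p. 87, Thm. 3.9 p. 10]
[cite: PlatonovRapinchuk1994, §6.4] -/
theorem u2_nilpotentFourierRegular_of_anisotropic (H : Matrix (Fin 2) (Fin 2) L) (hH : (H.map (cmConjRingHom L))ᵀ = H) (hdet : H.det ≠ 0)
    (hanis : ∀ u : Fin 2 → w.1.adicCompletion L,
      Literature.AlgebraicGeometry.ShimuraVarieties.hermForm (galAdicCompletionMap (L := L) (IsCMField.complexConj L) hw) (UnitaryGroup.placeForm H w.1) u u = 0 → u = 0)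
    (ψ : AddChar (w.1.adicCompletion L) Circle) (hψ : ψ.IsContinuousNontrivial)
    (hψι : ∃ a : w.1.adicCompletion L, galAdicCompletionMap (L := L) (IsCMField.complexConj L) hw a = a ∧ ψ a ≠ 1)
    [MeasurableSpace ↥(lieOfForm (galAdicCompletionMap (L := L) (IsCMField.complexConj L) hw) (UnitaryGroup.placeForm H w.1))]
    [BorelSpace ↥(lieOfForm (galAdicCompletionMap (L := L) (IsCMField.complexConj L) hw) (UnitaryGroup.placeForm H w.1))]
    (μ𝔤 : Measure ↥(lieOfForm (galAdicCompletionMap (L := L) (IsCMField.complexConj L) hw) (UnitaryGroup.placeForm H w.1))) [μ𝔤.IsAddHaarMeasure]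
    (T : (↥(lieOfForm (galAdicCompletionMap (L := L) (IsCMField.complexConj L) hw) (UnitaryGroup.placeForm H w.1)) → ℂ) → ℂ)
    (hT : (∀ f₁ f₂ : ↥(lieOfForm (galAdicCompletionMap (L := L) (IsCMField.complexConj L) hw) (UnitaryGroup.placeForm H w.1)) → ℂ, IsLocSmooth f₁ → IsLocSmooth f₂ → T (f₁ + f₂) = T f₁ + T f₂) ∧
         (∀ (a : ℂ) (f : ↥(lieOfForm (galAdicCompletionMap (L := L) (IsCMField.complexConj L) hw) (UnitaryGroup.placeForm H w.1)) → ℂ), IsLocSmooth f → T (a • f) = a * T f) ∧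
         (∀ (x : ↥(unitaryGroupOfForm (galAdicCompletionMap (L := L) (IsCMField.complexConj L) hw) (UnitaryGroup.placeForm H w.1))) (f : ↥(lieOfForm (galAdicCompletionMap (L := L) (IsCMField.complexConj L) hw) (UnitaryGroup.placeForm H w.1)) → ℂ), IsLocSmooth f →
            T (fun X => f ⟨((x : GL (Fin 2) (w.1.adicCompletion L)) : Matrix (Fin 2) (Fin 2) (w.1.adicCompletion L)) * X.1 * (((x : GL (Fin 2) (w.1.adicCompletion L))⁻¹ : GL (Fin 2) (w.1.adicCompletion L)) : Matrix (Fin 2) (Fin 2) (w.1.adicCompletion L)),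
              conj_mem_lieOfForm x.2 X.2⟩) = T f) ∧
         (∀ f : ↥(lieOfForm (galAdicCompletionMap (L := L) (IsCMField.complexConj L) hw) (UnitaryGroup.placeForm H w.1)) → ℂ, IsLocSmooth f → (∀ X ∈ tsupport f, ¬ IsNilpotent X.1) → T f = 0)) :
    ∃ Fn : ↥(lieOfForm (galAdicCompletionMap (L := L) (IsCMField.complexConj L) hw) (UnitaryGroup.placeForm H w.1)) → ℂ, LocallyIntegrable Fn μ𝔤 ∧
      (∀ f : ↥(lieOfForm (galAdicCompletionMap (L := L) (IsCMField.complexConj L) hw) (UnitaryGroup.placeForm H w.1)) → ℂ, IsLocSmooth f → T (lieFourier (galAdicCompletionMap (L := L) (IsCMField.complexConj L) hw) (UnitaryGroup.placeForm H w.1) (fun x : w.1.adicCompletion L => ((ψ x : Circle) : ℂ)) μ𝔤 f) = ∫ X, f X * Fn X ∂μ𝔤) ∧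
      (∀ X : ↥(lieOfForm (galAdicCompletionMap (L := L) (IsCMField.complexConj L) hw) (UnitaryGroup.placeForm H w.1)), IsUnit X.1.charpoly.discr → ∀ᶠ Y in 𝓝 X, Fn Y = Fn X) ∧
      (∀ C : Set ↥(lieOfForm (galAdicCompletionMap (L := L) (IsCMField.complexConj L) hw) (UnitaryGroup.placeForm H w.1)), IsCompact C → ∃ B : ℝ, ∀ X ∈ C,
          ((NNReal.sqrt (NNReal.sqrt (normAbs (w.1.adicCompletion L) X.1.charpoly.discr)) : ℝ≥0) : ℝ) * ‖Fn X‖ ≤ B) := by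
  obtain ⟨hadd, hsmul, -, hN⟩ := hT
  refine lieNilpotentFourierRegular_of_pointSupport L v w hw H hH hdet ψ hψ hψι μ𝔤 T hadd hsmul fun f hf h0f => hN f hf fun X hX hnil => h0f ?_
  have hX0 : X = 0 := Subtype.ext (eq_zero_of_isNilpotent_of_anisotropic (galAdicCompletionMap (L := L) (IsCMField.complexConj L) hw) hanis X.2 hnil)
  rwa [hX0] at hX

end CM

end Summit.HodgeConjecture.HodgeConjecture.Cruxes.H413.K2E3U2NilpotentFourierPointSupport

end
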